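import Summits.HodgeConjecture.HodgeConjecture.Theorems.SixfoldTableXCensusSexticGeneralRow
import Literature.AlgebraicGeometry.HodgeTheory.CMFieldThreeScalarMixedHodgeLie
import HarnessLib

/-!
# TABLE X (dimension 6) — row 10 `g6.IV(2,1)` (`End⁰ = E` a QUARTIC CM field, `dim_E H¹ = 3`), the members of CM PATTERN
# `(3,0)+(2,1)`: the census nodes X2 / X1 DISCHARGED IN THE KERNEL on the whole isogeny class, `hU` of L14 now DISCHARGED by
# the tree's one-scalar-one-mixed-place Lie theorem (Moonen–Zarhin 1999 (2.3); Ribet 1983 Thm. 0) — cell `pub-hodgeav-hg6`,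
# req-37 (A) Q2b, eng-5 g7

HONEST FRAMING. HC, `HC_AV` (stmt-1333), `HC_CM` (stmt-3052) and the rung H2 are NOT proved and do not occur here. The
census nodes `TableX.SixfoldCodimTwoCensus` (X2) / `TableX.SixfoldCodimThreeCensus` (X1) of `SixfoldTableXCover` are OURS
(`@[conjecture]`), never asserted — they quantify over ALL off-residue sixfolds; here they are DISCHARGED on one isogeny
class per hypothesis set. KERNEL ONLY: theorems over existing declarations; no definition, no `sorry`, no named fact, no
displayed Lie hypothesis; typed ≠ proved.

WHY THIS MODULE (census-node self-audit, axis A7 «a row VERIFIED in the kernel, not by dossier», continued). L14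
(`SixfoldTableXCensusQuarticGeneralRow`, eng-4 g5) put row 10 on A7 for the GENERAL member with the Lie hypothesis `hU`
(«every `(φ^*)_ℂ`-commuting `ψ_ℂ`-skew operator of `H¹(B(ℂ); ℂ)` lies in `Lie Hg(H¹(B)) ⊗ ℂ`», i.e. `Hg(B) = U_E(V,ψ)`)
DISPLAYED. The cell's U-programme for CM fields (eng-5 g6/g7: socket `CMThetaSocket.*`, centre `CMThetaCentre.*`
(`centre_of_unequal_pair`), derived algebra `CMDerived.*` (+ the relative `𝔰𝔩₃` theorem), equidimensionality of the place
projections `CMPlaces.*`, no-twist `CMNoTwist3.*`, irreducibility `CMIrred.*`, assembly `CMThetaThreeScalarMixed.*`,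
dictionary `AbelianVariety.hodgeLieC_of_cmField_threeScalarMixed`) now PROVES `hU` for every SIMPLE `B` with
`dim_ℚ End⁰(B) = 4`, `φ ∈ End(B)` with four pairwise non-conjugate eigenvalues of pair multiplicity `3`, and CM PATTERN
`(3,0)+(2,1)`: ONE place `k₀` with `eigenMultiplicity B φ (μ k₀) = 0` or `eigenMultiplicity B φ (conj μ k₀) = 0` (the
`Θ`-scalar place) and the other place MIXED (both multiplicities non-zero, i.e. `(2,1)` or `(1,2)`). THIS FILE is L14/L15's
§1–§2 with `hU` DISCHARGED for these members — nothing of L14 / L15 / L10 / G2 is restated, only applied: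
* §1 `census_of_isIsogenous_cmField_threeScalarMixed` — both census conclusions X2-at-`A`, X1-at-`A` at every `A ∼ B`
  (any `ι` with `|ι| ≤ 2`, `dim B = 3|ι|`); `hodgeConjectureFor_of_isIsogenous_cmField_threeScalarMixed` — L6's CONCLUSION
  `HodgeConjectureFor` on the whole isogeny class, UNCONDITIONAL.
* §2 `census_row10_quartic_threeScalarMixed` — TABLE X row 10, PATTERN `(3,0)+(2,1)`, ALL MEMBERS, KERNEL VERDICT: every
  `A ∼ B` is IN THE NODES' DOMAIN (`dim A = 6 ∧ ¬ 𝒞 A`: the hU-free half) AND satisfies X2-at-`A` ∧ X1-at-`A`;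
  `census_row10_quartic_threeScalarMixed_self`.

READING (honest scope). Row 10 (`E` quartic CM, `dim_E H¹ = 3`) has the CM patterns `(3,0)+(2,1)` (this file: Hg = U_E for
ALL its members — no Weil-type exception exists in this pattern: `3 + 2 ≠ 0 + 1`, `3 + 1 ≠ 0 + 2`) and `(2,1)+(2,1)` ∕
`(2,1)+(1,2)` (Hg = U_E unless `E ⊇ k` imaginary quadratic acting `(3,3)` = row 11: NOT covered here — it needs the no-Weil
hypothesis, the tree's `CMThetaCentre.centre_of_pair` plus a same-type no-twist theorem still to be written), and
`(3,0)+(3,0)`-type (CM / non-simple — outside the domain). HC / HC_AV are NOT proved beyond these isogeny-class statements'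
own content; X2 / X1 stay `@[conjecture]` globally. No inhabitant is exhibited and none is invented here.

All declarations live in the sub-namespace `TableX.TypeIVRows` (lead g2 DEDUP RULE: import the entry points, restate
nothing). Nothing here is a corollary of `HC_CM`; typed ≠ proved.
-/

set_option linter.dupNamespace false

noncomputable section

open scoped TensorProduct
open CategoryTheory
open Literature.AlgebraicGeometry Literature.AlgebraicGeometry.Motives
open Literature.AlgebraicGeometry.Motives.AbelianVariety (IsIsogenous IsSimple)
open Literature.AlgebraicGeometry.HodgeTheory
open Literature.AlgebraicGeometry.Milne1999
open Literature.AlgebraicTopology.SingularHomology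
open Literature.Barriers.HodgeConjecture
open Summit.HodgeConjecture.HodgeConjecture.Ring2.ClassTargets
open Summit.HodgeConjecture.HodgeConjecture.Ring2.Motiv (ProdCMCell)
open Summit.HodgeConjecture.HodgeConjecture.Ring2.Atlas (IsQuarticFieldTypeIVFourfold)
open Summit.HodgeConjecture.HodgeConjecture.TableX.SimpleRows

namespace Summit.HodgeConjecture.HodgeConjecture.TableX.TypeIVRows

/-! ## §1 CM field of degree `2|ι| ≤ 4`, multiplicity `3`, one `Θ`-scalar place, one mixed place: both census
conclusions and `HodgeConjectureFor` on the isogeny class, `hU` discharged -/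

/-- **Both census conclusions X2-at-`A`, X1-at-`A` at every `A` isogenous to a SIMPLE complex abelian variety `B` with
`dim_ℚ End⁰(B) = 2|ι|` (`|ι| ≤ 2`), `φ ∈ End(B)` with colours `μ : ι → ℂ` of pair multiplicity `3`, `dim B = 3|ι|`, and CM
pattern with ONE `Θ`-scalar place `k₀` and every other place mixed** — L15's `census_of_isIsogenous_cmFieldGeneral` with its
displayed Lie hypothesis `hU` DISCHARGED by `AbelianVariety.hodgeLieC_of_cmField_threeScalarMixed` (the polarization of `H¹(B(ℂ); ℚ)` and the Betti-universe
facts supplied by the tree's `smoothProjective_hodgeStructure_isPolarizable_holds`, `exists_isReal_hodgeModel_holds`,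
`hodgePQ_independent_of_hodgeModel_holds`). HC ∕ HC_AV NOT proved; X2 ∕ X1 stay `@[conjecture]` globally.
[cite: MoonenZarhin1999LowDim, §1 (1.8), §2 (2.3)] [cite: Ribet1983, Thm. 0] [cite: vanGeemen1994HodgeAV, §2.4 and Lemma 3.7]
[cite: MumfordAV1970, §19 Cor. 2 of Thm. 1 (p. 174)] -/
theorem census_of_isIsogenous_cmField_threeScalarMixed {ι : Type} [Fintype ι] [DecidableEq ι] (hι : Fintype.card ι ≤ 2)
    {A B : AbelianVariety ℂ} (hBs : B.IsSimple) (φ : B ⟶ B)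
    (hE : Module.finrank ℚ B.endAlgebra = 2 * Fintype.card ι) (μ : ι → ℂ) (hinj : Function.Injective μ)
    (hdist : ∀ k k', μ k' ≠ starRingEnd ℂ (μ k))
    (hmult : ∀ k, eigenMultiplicity B φ (μ k) + eigenMultiplicity B φ (starRingEnd ℂ (μ k)) = 3)
    (hdim : B.dim = Fintype.card ι * 3) (k₀ : ι)
    (hk₀ : eigenMultiplicity B φ (μ k₀) = 0 ∨ eigenMultiplicity B φ (starRingEnd ℂ (μ k₀)) = 0)
    (hmix : ∀ k, k ≠ k₀ → eigenMultiplicity B φ (μ k) ≠ 0 ∧ eigenMultiplicity B φ (starRingEnd ℂ (μ k)) ≠ 0)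
    (k₁ : ι) (hk₁ : k₁ ≠ k₀) (hAB : IsIsogenous A B) :
    (∀ c : complexBetti A.X (2 * 2), IsRationalClass c → IsOfHodgeType A.dim A.X (2 * 2) 2 2 c →
      c ∈ divisorClassesSpan A.X A.dim 2 ⊔ Submodule.span ℂ {w' : complexBetti A.X (2 * 2) |
        ∃ (C : AbelianVariety ℂ) (g : A.X ⟶ C.X) (w : complexBetti C.X (2 * 2)), C.dim < A.dim ∧
          IsRationalClass w ∧ IsOfHodgeType C.dim C.X (2 * 2) 2 2 w ∧ w' = complexBetti.map g (2 * 2) w}) ∧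
    (∀ c : complexBetti A.X (2 * 3), IsRationalClass c → IsOfHodgeType A.dim A.X (2 * 3) 3 3 c →
      c ∈ divisorClassesSpan A.X A.dim 3 ⊔ Submodule.span ℂ {w' : complexBetti A.X (2 * 3) |
          ∃ (a : complexBetti A.X (2 * 2)) (b : complexBetti A.X (2 * 1)),
            IsRationalClass a ∧ IsOfHodgeType A.dim A.X (2 * 2) 2 2 a ∧ IsRationalClass b ∧
            IsOfHodgeType A.dim A.X (2 * 1) 1 1 b ∧ w' = cupProduct (two_mul_add_two_mul 2 1) a b} ⊔
        Submodule.span ℂ {w' : complexBetti A.X (2 * 3) |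
          ∃ (C : AbelianVariety ℂ) (g : A.X ⟶ C.X) (w : complexBetti C.X (2 * 3)), C.dim < A.dim ∧
            IsRationalClass w ∧ IsOfHodgeType C.dim C.X (2 * 3) 3 3 w ∧ w' = complexBetti.map g (2 * 3) w} ⊔
        Submodule.span ℂ {w' : complexBetti A.X (2 * 3) |
          ∃ (B' : AbelianVariety ℂ) (g : A.X ⟶ B'.X) (d : ℕ) (ψ : B' ⟶ B') (w : complexBetti B'.X (2 * 3)),
            B'.dim = 6 ∧ 0 < d ∧ ψ ≫ ψ = -(d • 𝟙 B') ∧ IsRationalClass w ∧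
            IsOfHodgeType B'.dim B'.X (2 * 3) 3 3 w ∧ w ∈ weilClassesOf B' ψ 3 d ∧
            w' = complexBetti.map g (2 * 3) w}) := by
  have hHD : exists_isReal_hodgeModel := exists_isReal_hodgeModel_holds
  have hI : hodgePQ_independent_of_hodgeModel := hodgePQ_independent_of_hodgeModel_holds
  haveI : HodgeTensorFacts.{0, 0} := hodgeTensorFacts_holds.{0, 0}
  have hX : IsSmoothProjective B.dim B.X := AbelianVariety.isSmoothProjective_holds
  obtain ⟨ψ⟩ : (BettiUniverse.hodge hHD (AbelianVariety.isSmoothProjective_holds (A := B)) 1).IsPolarizable :=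
    smoothProjective_hodgeStructure_isPolarizable_holds hX (BettiUniverse.realHodgeModel hHD hX)
      (BettiUniverse.realHodgeModel_isHodgeSymmetric hHD hX) 1
  exact census_of_isIsogenous_cmFieldGeneral φ hE μ hinj hdist zero_lt_three hmult hdim hHD hI ψ
    (AbelianVariety.hodgeLieC_of_cmField_threeScalarMixed hι B hBs φ hE μ hinj hdist hmult hdim k₀ hk₀ hmix k₁ hk₁ hHD hI ψ)
    hAB

/-- **L6's CONCLUSION on the isogeny class, UNCONDITIONAL: the Hodge conjecture holds for every complex abelian variety
isogenous to a SIMPLE `B` with `dim_ℚ End⁰(B) = 2|ι|` (`|ι| ≤ 2`), `φ ∈ End(B)` of pair multiplicity `3`, `dim B = 3|ι|`,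
and CM pattern with ONE `Θ`-scalar place and every other place mixed** (L15's `hodgeConjectureFor_of_isIsogenous_cmFieldGeneral`
with `hU` discharged).
None of Markman₄ / Markman₆ / R-W6 / X2 / X1 / `HC_CM` enters. HC ∕ HC_AV NOT proved beyond this statement's own content.
[cite: MoonenZarhin1999LowDim, §1 (1.7)–(1.8) and §2 (2.3)] [cite: Ribet1983, Thm. 0] [cite: vanGeemen1994HodgeAV, §2.4 and Lemma 3.7] -/
theorem hodgeConjectureFor_of_isIsogenous_cmField_threeScalarMixed {ι : Type} [Fintype ι] [DecidableEq ι]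
    (hι : Fintype.card ι ≤ 2)
    {A B : AbelianVariety ℂ} (hBs : B.IsSimple) (φ : B ⟶ B)
    (hE : Module.finrank ℚ B.endAlgebra = 2 * Fintype.card ι) (μ : ι → ℂ) (hinj : Function.Injective μ)
    (hdist : ∀ k k', μ k' ≠ starRingEnd ℂ (μ k))
    (hmult : ∀ k, eigenMultiplicity B φ (μ k) + eigenMultiplicity B φ (starRingEnd ℂ (μ k)) = 3)
    (hdim : B.dim = Fintype.card ι * 3) (k₀ : ι)
    (hk₀ : eigenMultiplicity B φ (μ k₀) = 0 ∨ eigenMultiplicity B φ (starRingEnd ℂ (μ k₀)) = 0)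
    (hmix : ∀ k, k ≠ k₀ → eigenMultiplicity B φ (μ k) ≠ 0 ∧ eigenMultiplicity B φ (starRingEnd ℂ (μ k)) ≠ 0)
    (k₁ : ι) (hk₁ : k₁ ≠ k₀) (hAB : IsIsogenous A B) : HodgeConjectureFor A.dim A.X := by
  have hHD : exists_isReal_hodgeModel := exists_isReal_hodgeModel_holds
  have hI : hodgePQ_independent_of_hodgeModel := hodgePQ_independent_of_hodgeModel_holds
  haveI : HodgeTensorFacts.{0, 0} := hodgeTensorFacts_holds.{0, 0}
  have hX : IsSmoothProjective B.dim B.X := AbelianVariety.isSmoothProjective_holds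
  obtain ⟨ψ⟩ : (BettiUniverse.hodge hHD (AbelianVariety.isSmoothProjective_holds (A := B)) 1).IsPolarizable :=
    smoothProjective_hodgeStructure_isPolarizable_holds hX (BettiUniverse.realHodgeModel hHD hX)
      (BettiUniverse.realHodgeModel_isHodgeSymmetric hHD hX) 1
  exact hodgeConjectureFor_of_isIsogenous_cmFieldGeneral φ hE μ hinj hdist zero_lt_three hmult hdim hHD hI ψ
    (AbelianVariety.hodgeLieC_of_cmField_threeScalarMixed hι B hBs φ hE μ hinj hdist hmult hdim k₀ hk₀ hmix k₁ hk₁ hHD hI ψ)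
    hAB

/-! ## §2 TABLE X row 10 `g6.IV(2,1)`, CM pattern `(3,0)+(2,1)`, ALL MEMBERS: kernel verdict with domain membership -/

/-- **TABLE X ROW 10 `g6.IV(2,1)`, CM PATTERN `(3,0)+(2,1)`, ALL MEMBERS — KERNEL VERDICT on the whole isogeny class, no
displayed hypothesis.** For a SIMPLE complex abelian SIXFOLD `B` with `dim_ℚ End⁰(B) = 4`, `φ ∈ End(B)` with colours
`μ : Fin 2 → ℂ` (injective, none conjugate to another or itself) of pair multiplicity `3` — so `E = End⁰(B) = ℚ(φ)` is a
quartic CM field with `dim_E H¹(B;ℚ) = 3` — and CM PATTERN `(3,0)+(2,1)` (one place `k₀` with `eigenMultiplicity B φ (μ k₀) = 0`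
or `eigenMultiplicity B φ (conj μ k₀) = 0`, the other place mixed), and for every `A` isogenous to `B`: `dim A = 6` and `A`
is OFF the residue class `𝒞` (the hU-free half: `B` simple and not of CM type since `dim_ℚ End⁰(B) = 4 < 12`), AND both
census conclusions X2-at-`A`, X1-at-`A` hold (§1 at `ι = Fin 2`). This is L14's `census_row10_quarticGeneral` with `hU`
DISCHARGED for the pattern `(3,0)+(2,1)`: these members of row 10 join A7 («Hg = U_E» is a kernel theorem for them). The
pattern `(2,1)+(2,1)` (needs «no Weil-type quadratic subfield») is NOT covered. HC ∕ HC_AV NOT proved; X2 ∕ X1 stay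
`@[conjecture]` globally. [cite: MoonenZarhin1999LowDim, §1 (1.8), §2 (2.3) and §5 (5.1)] [cite: Ribet1983, Thm. 0]
[cite: vanGeemen1994HodgeAV, Lemma 3.7] [cite: MumfordAV1970, §19 Cor. 2 of Thm. 1 (p. 174)] [cite: Milne1999, §2 p. 54] -/
theorem census_row10_quartic_threeScalarMixed {A B : AbelianVariety ℂ} (hB : B.dim = 6) (hBs : B.IsSimple) (φ : B ⟶ B)
    (hE4 : Module.finrank ℚ B.endAlgebra = 4) (μ : Fin 2 → ℂ) (hinj : Function.Injective μ)
    (hdist : ∀ k k', μ k' ≠ starRingEnd ℂ (μ k))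
    (hmult : ∀ k, eigenMultiplicity B φ (μ k) + eigenMultiplicity B φ (starRingEnd ℂ (μ k)) = 3) (k₀ : Fin 2)
    (hk₀ : eigenMultiplicity B φ (μ k₀) = 0 ∨ eigenMultiplicity B φ (starRingEnd ℂ (μ k₀)) = 0)
    (hmix : ∀ k, k ≠ k₀ → eigenMultiplicity B φ (μ k) ≠ 0 ∧ eigenMultiplicity B φ (starRingEnd ℂ (μ k)) ≠ 0)
    (hAB : IsIsogenous A B) :
    (A.dim = 6 ∧ ¬ (IsOfCMType A ∨ ProdCMCell IsQuarticFieldTypeIVFourfold (fun Z ↦ Z.dim = 2) A)) ∧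
    (∀ c : complexBetti A.X (2 * 2), IsRationalClass c → IsOfHodgeType A.dim A.X (2 * 2) 2 2 c →
      c ∈ divisorClassesSpan A.X A.dim 2 ⊔ Submodule.span ℂ {w' : complexBetti A.X (2 * 2) |
        ∃ (C : AbelianVariety ℂ) (g : A.X ⟶ C.X) (w : complexBetti C.X (2 * 2)), C.dim < A.dim ∧
          IsRationalClass w ∧ IsOfHodgeType C.dim C.X (2 * 2) 2 2 w ∧ w' = complexBetti.map g (2 * 2) w}) ∧
    (∀ c : complexBetti A.X (2 * 3), IsRationalClass c → IsOfHodgeType A.dim A.X (2 * 3) 3 3 c →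
      c ∈ divisorClassesSpan A.X A.dim 3 ⊔ Submodule.span ℂ {w' : complexBetti A.X (2 * 3) |
          ∃ (a : complexBetti A.X (2 * 2)) (b : complexBetti A.X (2 * 1)),
            IsRationalClass a ∧ IsOfHodgeType A.dim A.X (2 * 2) 2 2 a ∧ IsRationalClass b ∧
            IsOfHodgeType A.dim A.X (2 * 1) 1 1 b ∧ w' = cupProduct (two_mul_add_two_mul 2 1) a b} ⊔
        Submodule.span ℂ {w' : complexBetti A.X (2 * 3) |
          ∃ (C : AbelianVariety ℂ) (g : A.X ⟶ C.X) (w : complexBetti C.X (2 * 3)), C.dim < A.dim ∧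
            IsRationalClass w ∧ IsOfHodgeType C.dim C.X (2 * 3) 3 3 w ∧ w' = complexBetti.map g (2 * 3) w} ⊔
        Submodule.span ℂ {w' : complexBetti A.X (2 * 3) |
          ∃ (B' : AbelianVariety ℂ) (g : A.X ⟶ B'.X) (d : ℕ) (ψ : B' ⟶ B') (w : complexBetti B'.X (2 * 3)),
            B'.dim = 6 ∧ 0 < d ∧ ψ ≫ ψ = -(d • 𝟙 B') ∧ IsRationalClass w ∧
            IsOfHodgeType B'.dim B'.X (2 * 3) 3 3 w ∧ w ∈ weilClassesOf B' ψ 3 d ∧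
            w' = complexBetti.map g (2 * 3) w}) :=
  have hk₁ : k₀ + 1 ≠ k₀ := by fin_cases k₀ <;> decide
  ⟨offResidueSix_of_isIsogenous_of_isSimple_of_not_isOfCMType hAB hB hBs
      (not_isOfCMType_of_finrank_endAlgebra_lt_two_mul_dim (by omega)),
    census_of_isIsogenous_cmField_threeScalarMixed (by rw [Fintype.card_fin]) hBs φ (by rw [hE4, Fintype.card_fin]) μ hinj
      hdist hmult (by rw [hB, Fintype.card_fin]) k₀ hk₀ hmix (k₀ + 1) hk₁ hAB⟩

/-- **Row 10, CM pattern `(3,0)+(2,1)`, the model itself**: `B` is in the nodes' domain and satisfies X2-at-`B` ∧ X1-at-`B`, no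
displayed hypothesis (the case `A = B` of `census_row10_quartic_threeScalarMixed`). HC ∕ HC_AV NOT proved.
[cite: MoonenZarhin1999LowDim, §1 (1.8) and §2 (2.3)] [cite: Ribet1983, Thm. 0] -/
theorem census_row10_quartic_threeScalarMixed_self {B : AbelianVariety ℂ} (hB : B.dim = 6) (hBs : B.IsSimple) (φ : B ⟶ B)
    (hE4 : Module.finrank ℚ B.endAlgebra = 4) (μ : Fin 2 → ℂ) (hinj : Function.Injective μ)
    (hdist : ∀ k k', μ k' ≠ starRingEnd ℂ (μ k))
    (hmult : ∀ k, eigenMultiplicity B φ (μ k) + eigenMultiplicity B φ (starRingEnd ℂ (μ k)) = 3) (k₀ : Fin 2)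
    (hk₀ : eigenMultiplicity B φ (μ k₀) = 0 ∨ eigenMultiplicity B φ (starRingEnd ℂ (μ k₀)) = 0)
    (hmix : ∀ k, k ≠ k₀ → eigenMultiplicity B φ (μ k) ≠ 0 ∧ eigenMultiplicity B φ (starRingEnd ℂ (μ k)) ≠ 0) :
    (B.dim = 6 ∧ ¬ (IsOfCMType B ∨ ProdCMCell IsQuarticFieldTypeIVFourfold (fun Z ↦ Z.dim = 2) B)) ∧
    (∀ c : complexBetti B.X (2 * 2), IsRationalClass c → IsOfHodgeType B.dim B.X (2 * 2) 2 2 c →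
      c ∈ divisorClassesSpan B.X B.dim 2 ⊔ Submodule.span ℂ {w' : complexBetti B.X (2 * 2) |
        ∃ (C : AbelianVariety ℂ) (g : B.X ⟶ C.X) (w : complexBetti C.X (2 * 2)), C.dim < B.dim ∧
          IsRationalClass w ∧ IsOfHodgeType C.dim C.X (2 * 2) 2 2 w ∧ w' = complexBetti.map g (2 * 2) w}) ∧
    (∀ c : complexBetti B.X (2 * 3), IsRationalClass c → IsOfHodgeType B.dim B.X (2 * 3) 3 3 c →
      c ∈ divisorClassesSpan B.X B.dim 3 ⊔ Submodule.span ℂ {w' : complexBetti B.X (2 * 3) |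
          ∃ (a : complexBetti B.X (2 * 2)) (b : complexBetti B.X (2 * 1)),
            IsRationalClass a ∧ IsOfHodgeType B.dim B.X (2 * 2) 2 2 a ∧ IsRationalClass b ∧
            IsOfHodgeType B.dim B.X (2 * 1) 1 1 b ∧ w' = cupProduct (two_mul_add_two_mul 2 1) a b} ⊔
        Submodule.span ℂ {w' : complexBetti B.X (2 * 3) |
          ∃ (C : AbelianVariety ℂ) (g : B.X ⟶ C.X) (w : complexBetti C.X (2 * 3)), C.dim < B.dim ∧
            IsRationalClass w ∧ IsOfHodgeType C.dim C.X (2 * 3) 3 3 w ∧ w' = complexBetti.map g (2 * 3) w} ⊔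
        Submodule.span ℂ {w' : complexBetti B.X (2 * 3) |
          ∃ (B' : AbelianVariety ℂ) (g : B.X ⟶ B'.X) (d : ℕ) (ψ : B' ⟶ B') (w : complexBetti B'.X (2 * 3)),
            B'.dim = 6 ∧ 0 < d ∧ ψ ≫ ψ = -(d • 𝟙 B') ∧ IsRationalClass w ∧
            IsOfHodgeType B'.dim B'.X (2 * 3) 3 3 w ∧ w ∈ weilClassesOf B' ψ 3 d ∧
            w' = complexBetti.map g (2 * 3) w}) :=
  census_row10_quartic_threeScalarMixed hB hBs φ hE4 μ hinj hdist hmult k₀ hk₀ hmix (IsIsogenous.refl B)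

end Summit.HodgeConjecture.HodgeConjecture.TableX.TypeIVRows

end
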